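import Summits.BirchSwinnertonDyer.BirchSwinnertonDyer.Theorems.Rank2ObservatoryKernelWalker
import Summits.BirchSwinnertonDyer.BirchSwinnertonDyer.Theorems.Rank2ObservatoryReductionWitnessT
import HarnessLib

/-!
# BirchSwinnertonDyer — rank ≥ 2 observatory: kernel-certificate WALKER, torsion `ℤ/2`, `ℤ/4`

HONEST FRAMING: per-curve certified theorems and census instruments; no claim on BSD in rank ≥ 2.

Companion of `Rank2ObservatoryKernelWalker`: certificate DATA (`TCert`) and a Boolean CHECK for the
rows whose rational `2`-power torsion is `ℤ/2` (`CertT.z2`, the hypotheses of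
`two_le_mordellWeilRank_of_kernelCertT3`) or `ℤ/4` (`CertT.z4`, those of
`two_le_mordellWeilRank_of_kernelCertT4`, `Rank2ObservatoryReductionWitnessT`), on the SCALED model
`scaleModel V d` (listed generators / torsion points made integral; same rank,
`mordellWeilRank_scaleModel`). Soundness `two_le_mordellWeilRank_of_certCheckT` is proved ONCE; a
data file lists `(row, certificate)` pairs and ONE `decide +kernel` per segment evaluates
`List.all certRowCheckT`; `two_le_mordellWeilRank_of_all_certRowCheckT` turns that into
`∀ r ∈ rows, 2 ≤ rank_ℤ E_r(ℚ)` (no hypothesis). Primality of every witness prime is part of the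
check (`goodPrimeB`: Mathlib's `Nat.decidablePrime`), so no `Fact` instances are needed in data
files.

References: Cremona, *Algorithms for Modular Elliptic Curves* (1997), Table 1, §2.4, §3.5;
Silverman,
*The Arithmetic of Elliptic Curves* (2009), III.2.3, III.3.1(b), VII.3.1(b), VII.3.4, VIII.6.7.
-/

-- single-conjunct summit: `Summit.BirchSwinnertonDyer.BirchSwinnertonDyer.…` repeats the name
-- by design
set_option linter.dupNamespace false

namespace Summit.BirchSwinnertonDyer.BirchSwinnertonDyer.Rank2Observatory

open WeierstrassCurve

section ChecksT

variable (V : WeierstrassCurve ℤ)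

/-- `(X, Y) ∈ ℤ²` satisfies the Weierstrass equation of `V` (Boolean). [cite: SilvermanAEC2009,
III.1] -/
def onCurveZ (X Y : ℤ) : Bool :=
  decide (Y ^ 2 + V.a₁ * X * Y + V.a₃ * Y = X ^ 3 + V.a₂ * X ^ 2 + V.a₄ * X + V.a₆)

/-- `onCurveZ` is sound. [cite: SilvermanAEC2009, III.1] -/
theorem onCurveZ_spec {X Y : ℤ} (h : onCurveZ V X Y = true) :
    Y ^ 2 + V.a₁ * X * Y + V.a₃ * Y = X ^ 3 + V.a₂ * X ^ 2 + V.a₄ * X + V.a₆ :=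
  of_decide_eq_true h

/-- `ℓ₁`-witness for `E(ℚ)[2] = {O, T}` (Boolean): `ℓ₁` a good odd prime at which `T̃` is the only
affine `2`-torsion point. [cite: SilvermanAEC2009, VII.3.1(b)] -/
def twoTorsB : ℕ → ℤ → ℤ → Bool
  | 0, _, _ => false
  | q + 1, xT, yT => goodPrimeB V (q + 1) && decide (q + 1 ≠ 2) && twoTorsionOnlyB V (q + 1) xT yT

/-- `ℓ₁`-witness for `E(ℚ)[2^∞] = ℤ/4 = ⟨T₄⟩` (Boolean): as `twoTorsB` plus `halfTOnlyB` (the halves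
of
`T̃` are `± T̃₄` only). [cite: SilvermanAEC2009, VII.3.1(b)] -/
def fourTorsB : ℕ → ℤ → ℤ → ℤ → ℤ → Bool
  | 0, _, _, _, _ => false
  | q + 1, xT, yT, x₄, y₄ =>
    goodPrimeB V (q + 1) && decide (q + 1 ≠ 2) && twoTorsionOnlyB V (q + 1) xT yT &&
      halfTOnlyB V (q + 1) xT x₄ y₄

/-- Torsion-coset witness (Boolean): `q` a good prime and `tCosetFree` for the point `(X, Y)` w.r.t.
the
torsion generator `(xT, yT)` with shift witness `(A, B)`. [cite: SilvermanAEC2009, III.2.3] -/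
def tcosB : ℕ → ℤ → ℤ → ℤ → ℤ → ℤ → ℤ → Bool
  | 0, _, _, _, _, _, _ => false
  | q + 1, xT, yT, X, Y, A, B =>
    goodPrimeB V (q + 1) &&
      tCosetFree V (q + 1) (xT : ZMod (q + 1)) (yT : ZMod (q + 1)) (X : ZMod (q + 1))
        (Y : ZMod (q + 1)) (A : ZMod (q + 1)) (B : ZMod (q + 1))

/-- Chord + torsion-coset witness for `P₁ + P₂` (Boolean): `q` a good prime, `(X₁₂, Y₁₂)` the chord
sum
of the residues mod `q` (`zmodChord`), and `tCosetFree` for it. [cite: SilvermanAEC2009, III.2.3] -/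
def chordTcosB : ℕ → ℤ → ℤ → ℤ → ℤ → ℤ → ℤ → ℤ → ℤ → ℤ → ℤ → Bool
  | 0, _, _, _, _, _, _, _, _, _, _ => false
  | q + 1, X₁, Y₁, X₂, Y₂, X₁₂, Y₁₂, xT, yT, A, B =>
    goodPrimeB V (q + 1) &&
      zmodChord V (q + 1) (X₁ : ZMod (q + 1)) (Y₁ : ZMod (q + 1)) (X₂ : ZMod (q + 1))
        (Y₂ : ZMod (q + 1)) (X₁₂ : ZMod (q + 1)) (Y₁₂ : ZMod (q + 1)) &&
      tCosetFree V (q + 1) (xT : ZMod (q + 1)) (yT : ZMod (q + 1)) (X₁₂ : ZMod (q + 1))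
        (Y₁₂ : ZMod (q + 1)) (A : ZMod (q + 1)) (B : ZMod (q + 1))

end ChecksT

/-- Certificate DATA for the torsion classes `ℤ/2` and `ℤ/4`: a scale `d`, two integral points of
the
scaled model, killers and annihilator `t = 2^e·m`, the `2`-torsion point `T` (and a `4`-torsion
point
`T₄` with `2T₄ = T` for `ℤ/4`; unused for `ℤ/2`), the torsion witness primes `ℓ₁`, `ℓ₂`, the coset
witness primes `q₁`, `q₂`, `q₁₂` with their shift witnesses, and the chord residues of `P₁ + P₂` mod
`q₁₂`. [cite: CremonaAlgorithms1997, §3.5] -/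
structure TCert where
  /-- scale: the certificate lives on `scaleModel V d` -/
  d : ℤ
  /-- `x(P₁)` (scaled model) -/
  X₁ : ℤ
  /-- `y(P₁)` -/
  Y₁ : ℤ
  /-- `x(P₂)` -/
  X₂ : ℤ
  /-- `y(P₂)` -/
  Y₂ : ℤ
  /-- killers `(ℓ, #Ẽ(𝔽_ℓ))` -/
  S : List (ℕ × ℕ)
  /-- torsion annihilator `t = 2^e·m` -/
  t : ℕ
  /-- `2`-exponent of `t` -/
  e : ℕ
  /-- odd part of `t` -/
  m : ℕ
  /-- `x(T)`, `T` the rational `2`-torsion point -/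
  xT : ℤ
  /-- `y(T)` -/
  yT : ℤ
  /-- `x(T₄)` (`ℤ/4` only) -/
  x₄ : ℤ
  /-- `y(T₄)` -/
  y₄ : ℤ
  /-- torsion-structure witness prime (odd, good) -/
  ℓ₁ : ℕ
  /-- non-doubling witness prime for the torsion generator -/
  ℓ₂ : ℕ
  /-- coset witness prime for `P₁` -/
  q₁ : ℕ
  /-- coset witness prime for `P₂` -/
  q₂ : ℕ
  /-- coset witness prime for `P₁ + P₂` -/
  q₁₂ : ℕ
  /-- shift witness for `P₁` mod `q₁` -/
  A₁ : ℤ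
  /-- shift witness for `P₁` mod `q₁` -/
  B₁ : ℤ
  /-- shift witness for `P₂` mod `q₂` -/
  A₂ : ℤ
  /-- shift witness for `P₂` mod `q₂` -/
  B₂ : ℤ
  /-- `x(P₁ + P₂) mod q₁₂` -/
  X₁₂ : ℤ
  /-- `y(P₁ + P₂) mod q₁₂` -/
  Y₁₂ : ℤ
  /-- shift witness for `P₁ + P₂` mod `q₁₂` -/
  A₁₂ : ℤ
  /-- shift witness for `P₁ + P₂` mod `q₁₂` -/
  B₁₂ : ℤ

namespace TCert

variable (V : WeierstrassCurve ℤ) (c : TCert)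

/-- Check for class `ℤ/2`: the hypotheses of `two_le_mordellWeilRank_of_kernelCertT3` on
`scaleModel V d`. -/
def checkZ2 : Bool :=
  decide (c.d ≠ 0) && onCurveZ (scaleModel V c.d) c.X₁ c.Y₁ &&
    onCurveZ (scaleModel V c.d) c.X₂ c.Y₂ &&
    (c.m % 2 == 1) && (c.t == 2 ^ c.e * c.m) && c.S.all (killerB (scaleModel V c.d)) &&
    annihilatorCheck c.S c.t && onCurveZ (scaleModel V c.d) c.xT c.yT &&
    decide (2 * c.yT + (scaleModel V c.d).a₁ * c.xT + (scaleModel V c.d).a₃ = 0) &&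
    twoTorsB (scaleModel V c.d) c.ℓ₁ c.xT c.yT && dblWitnessB (scaleModel V c.d) c.ℓ₂ c.xT &&
    tcosB (scaleModel V c.d) c.q₁ c.xT c.yT c.X₁ c.Y₁ c.A₁ c.B₁ &&
    tcosB (scaleModel V c.d) c.q₂ c.xT c.yT c.X₂ c.Y₂ c.A₂ c.B₂ &&
    chordTcosB (scaleModel V c.d) c.q₁₂ c.X₁ c.Y₁ c.X₂ c.Y₂ c.X₁₂ c.Y₁₂ c.xT c.yT c.A₁₂ c.B₁₂

/-- Check for class `ℤ/4`: the hypotheses of `two_le_mordellWeilRank_of_kernelCertT4` on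
`scaleModel V d`. -/
def checkZ4 : Bool :=
  decide (c.d ≠ 0) && onCurveZ (scaleModel V c.d) c.X₁ c.Y₁ &&
    onCurveZ (scaleModel V c.d) c.X₂ c.Y₂ &&
    (c.m % 2 == 1) && (c.t == 2 ^ c.e * c.m) && c.S.all (killerB (scaleModel V c.d)) &&
    annihilatorCheck c.S c.t && onCurveZ (scaleModel V c.d) c.xT c.yT &&
    decide (2 * c.yT + (scaleModel V c.d).a₁ * c.xT + (scaleModel V c.d).a₃ = 0) &&
    onCurveZ (scaleModel V c.d) c.x₄ c.y₄ && intTangent (scaleModel V c.d) c.x₄ c.y₄ c.xT c.yT &&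
    fourTorsB (scaleModel V c.d) c.ℓ₁ c.xT c.yT c.x₄ c.y₄ &&
    dblWitnessB (scaleModel V c.d) c.ℓ₂ c.x₄ &&
    tcosB (scaleModel V c.d) c.q₁ c.x₄ c.y₄ c.X₁ c.Y₁ c.A₁ c.B₁ &&
    tcosB (scaleModel V c.d) c.q₂ c.x₄ c.y₄ c.X₂ c.Y₂ c.A₂ c.B₂ &&
    chordTcosB (scaleModel V c.d) c.q₁₂ c.X₁ c.Y₁ c.X₂ c.Y₂ c.X₁₂ c.Y₁₂ c.x₄ c.y₄ c.A₁₂ c.B₁₂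

/-- Soundness, class `ℤ/2`. [cite: SilvermanAEC2009, Thm. VIII.6.7] [cite: SilvermanAEC2009,
III.3.1(b)]
[cite: CremonaAlgorithms1997, §3.5] -/
theorem two_le_of_checkZ2 (h : c.checkZ2 V = true) :
    2 ≤ (V.map (Int.castRingHom ℚ)).mordellWeilRank := by
  obtain ⟨d, X₁, Y₁, X₂, Y₂, S, t, e, m, xT, yT, x₄, y₄, ℓ₁, ℓ₂, q₁, q₂, q₁₂, A₁, B₁, A₂, B₂,
    X₁₂, Y₁₂, A₁₂, B₁₂⟩ := c
  simp only [checkZ2, Bool.and_eq_true, beq_iff_eq, decide_eq_true_eq] at h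
  obtain ⟨⟨⟨⟨⟨⟨⟨⟨⟨⟨⟨⟨⟨hd, h₁⟩, h₂⟩, hm⟩, hte⟩, hS⟩, ht⟩, hT⟩, hT2⟩, hl₁⟩, hl₂⟩, hw₁⟩,
    hw₂⟩, hw₁₂⟩ := h
  cases ℓ₁ with
  | zero => simp [twoTorsB] at hl₁
  | succ ℓ₁ =>
  cases ℓ₂ with
  | zero => simp [dblWitnessB] at hl₂
  | succ ℓ₂ =>
  cases q₁ with
  | zero => simp [tcosB] at hw₁
  | succ q₁ =>
  cases q₂ with
  | zero => simp [tcosB] at hw₂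
  | succ q₂ =>
  cases q₁₂ with
  | zero => simp [chordTcosB] at hw₁₂
  | succ q₁₂ =>
  simp only [twoTorsB, goodPrimeB, Bool.and_eq_true, decide_eq_true_eq] at hl₁
  simp only [dblWitnessB, goodPrimeB, Bool.and_eq_true, decide_eq_true_eq] at hl₂
  simp only [tcosB, goodPrimeB, Bool.and_eq_true, decide_eq_true_eq] at hw₁ hw₂
  simp only [chordTcosB, goodPrimeB, Bool.and_eq_true, decide_eq_true_eq] at hw₁₂
  haveI : Fact (ℓ₁ + 1).Prime := ⟨hl₁.1.1.1⟩
  haveI : Fact (ℓ₂ + 1).Prime := ⟨hl₂.1.1⟩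
  haveI : Fact (q₁ + 1).Prime := ⟨hw₁.1.1⟩
  haveI : Fact (q₂ + 1).Prime := ⟨hw₂.1.1⟩
  haveI : Fact (q₁₂ + 1).Prime := ⟨hw₁₂.1.1.1⟩
  rw [← mordellWeilRank_scaleModel V hd]
  exact two_le_mordellWeilRank_of_kernelCertT3 (scaleModel V d) (onCurveZ_spec _ h₁)
    (onCurveZ_spec _ h₂) hm hte (killers_of_all_killerB _ hS) ht (onCurveZ_spec _ hT) hT2 (ℓ₁ + 1)
    hl₁.1.1.2 hl₁.1.2 hl₁.2 (ℓ₂ + 1) hl₂.1.2 hl₂.2 (q₁ + 1) (q₂ + 1) (q₁₂ + 1) hw₁.1.2 hw₂.1.2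
    hw₁₂.1.1.2 hw₁.2 hw₂.2 hw₁₂.1.2 hw₁₂.2

/-- Soundness, class `ℤ/4`. [cite: SilvermanAEC2009, Thm. VIII.6.7] [cite: SilvermanAEC2009,
III.3.1(b)]
[cite: CremonaAlgorithms1997, §3.5] -/
theorem two_le_of_checkZ4 (h : c.checkZ4 V = true) :
    2 ≤ (V.map (Int.castRingHom ℚ)).mordellWeilRank := by
  obtain ⟨d, X₁, Y₁, X₂, Y₂, S, t, e, m, xT, yT, x₄, y₄, ℓ₁, ℓ₂, q₁, q₂, q₁₂, A₁, B₁, A₂, B₂,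
    X₁₂, Y₁₂, A₁₂, B₁₂⟩ := c
  simp only [checkZ4, Bool.and_eq_true, beq_iff_eq, decide_eq_true_eq] at h
  obtain ⟨⟨⟨⟨⟨⟨⟨⟨⟨⟨⟨⟨⟨⟨⟨hd, h₁⟩, h₂⟩, hm⟩, hte⟩, hS⟩, ht⟩, hT⟩, hT2⟩, h₄⟩, htan⟩, hl₁⟩,
    hl₂⟩, hw₁⟩, hw₂⟩, hw₁₂⟩ := h
  cases ℓ₁ with
  | zero => simp [fourTorsB] at hl₁
  | succ ℓ₁ =>
  cases ℓ₂ with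
  | zero => simp [dblWitnessB] at hl₂
  | succ ℓ₂ =>
  cases q₁ with
  | zero => simp [tcosB] at hw₁
  | succ q₁ =>
  cases q₂ with
  | zero => simp [tcosB] at hw₂
  | succ q₂ =>
  cases q₁₂ with
  | zero => simp [chordTcosB] at hw₁₂
  | succ q₁₂ =>
  simp only [fourTorsB, goodPrimeB, Bool.and_eq_true, decide_eq_true_eq] at hl₁
  simp only [dblWitnessB, goodPrimeB, Bool.and_eq_true, decide_eq_true_eq] at hl₂
  simp only [tcosB, goodPrimeB, Bool.and_eq_true, decide_eq_true_eq] at hw₁ hw₂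
  simp only [chordTcosB, goodPrimeB, Bool.and_eq_true, decide_eq_true_eq] at hw₁₂
  haveI : Fact (ℓ₁ + 1).Prime := ⟨hl₁.1.1.1.1⟩
  haveI : Fact (ℓ₂ + 1).Prime := ⟨hl₂.1.1⟩
  haveI : Fact (q₁ + 1).Prime := ⟨hw₁.1.1⟩
  haveI : Fact (q₂ + 1).Prime := ⟨hw₂.1.1⟩
  haveI : Fact (q₁₂ + 1).Prime := ⟨hw₁₂.1.1.1⟩
  rw [← mordellWeilRank_scaleModel V hd]
  exact two_le_mordellWeilRank_of_kernelCertT4 (scaleModel V d) (onCurveZ_spec _ h₁)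
    (onCurveZ_spec _ h₂) hm hte (killers_of_all_killerB _ hS) ht (onCurveZ_spec _ hT) hT2
    (onCurveZ_spec _ h₄) htan (ℓ₁ + 1) hl₁.1.1.1.2 hl₁.1.1.2 hl₁.1.2 hl₁.2 (ℓ₂ + 1) hl₂.1.2 hl₂.2
    (q₁ + 1) (q₂ + 1) (q₁₂ + 1) hw₁.1.2 hw₂.1.2 hw₁₂.1.1.2 hw₁.2 hw₂.2 hw₁₂.1.2 hw₁₂.2

end TCert

/-- The two torsion-class certificate shapes. [cite: CremonaAlgorithms1997, §3.5] -/
inductive CertT where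
  /-- `E(ℚ)[2^∞] = ℤ/2` (`two_le_mordellWeilRank_of_kernelCertT3`) -/
  | z2 (c : TCert)
  /-- `E(ℚ)[2^∞] = ℤ/4` (`two_le_mordellWeilRank_of_kernelCertT4`) -/
  | z4 (c : TCert)

/-- The certificate check (Boolean, evaluated by `decide +kernel`). -/
def CertT.check (V : WeierstrassCurve ℤ) : CertT → Bool
  | .z2 c => c.checkZ2 V
  | .z4 c => c.checkZ4 V

/-- **Soundness of the torsion-class certificate check**: `c.check V = true → 2 ≤ rank_ℤ E_V(ℚ)`.
[cite: SilvermanAEC2009, Thm. VIII.6.7] [cite: CremonaAlgorithms1997, §3.5] -/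
theorem two_le_mordellWeilRank_of_certCheckT (V : WeierstrassCurve ℤ) :
    ∀ c : CertT, c.check V = true → 2 ≤ (V.map (Int.castRingHom ℚ)).mordellWeilRank
  | .z2 c, h => c.two_le_of_checkZ2 V h
  | .z4 c, h => c.two_le_of_checkZ4 V h

/-- Row-level check: the certificate checks against the row's own integral model. -/
def certRowCheckT (p : Rank2Row × CertT) : Bool :=
  p.2.check p.1.intModel

/-- **The walker (torsion classes).** If every (row, certificate) pair of `L` checks, every row of
`L`
has `2 ≤ rank_ℤ E(ℚ)` — no hypothesis. [cite: SilvermanAEC2009, Thm. VIII.6.7]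
[cite: CremonaAlgorithms1997, Table 1, §3.5] -/
theorem two_le_mordellWeilRank_of_all_certRowCheckT {L : List (Rank2Row × CertT)}
    (h : L.all certRowCheckT = true) : ∀ r ∈ L.map Prod.fst, 2 ≤ r.curve.mordellWeilRank := by
  intro r hr
  obtain ⟨p, hp, rfl⟩ := List.mem_map.mp hr
  rw [Rank2Row.curve_eq_map_intModel]
  exact two_le_mordellWeilRank_of_certCheckT _ _ (List.all_eq_true.mp h p hp)

end Summit.BirchSwinnertonDyer.BirchSwinnertonDyer.Rank2Observatory
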